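import Mathlib
import Literature.IUT.LogVolume.UnitLogWildDepth
import Literature.IUT.LogVolume.LogUnitsRootTwist
import Literature.IUT.LogVolume.LogSeriesEstimates
import Literature.IUT.LogVolume.UnitLogWildQuadraticDyadic
import Literature.IUT.LogVolume.UnitLogTieAttained
import Literature.IUT.LogVolume.UnitLogNormTrace
import Literature.IUT.LogVolume.UnitLogKernel
import Literature.IUT.LogVolume.UnitLogFibres
import Literature.IUT.LogVolume.TorsionUnits
import Literature.IUT.LogVolume.UnitLogVolume
import Literature.IUT.LogVolume.LocalUnitLogEquivariance

/-!
# STUB-IDEAS k3 (gen 30) — «UNIFORMITY IS A TREE THEOREM»: R196″'s one structural unknown at `v`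
# (uniformity-in-`n` of the dyadic unit-logarithm digits over the keyed tower `L_n/F_n`) DISCHARGED BY NAME
# from the tree's `p`-adic unit-logarithm library (`Literature/IUT/LogVolume/*`, abc-iut cell — cited by no
# earlier card of this crux), in the PROJECTION-FREE presentation (B46), with the limit glue of R197a's
# skeleton (`Λog` on `lim_N U¹(L_n)`: Kummer limit ⊕ Yager basis ⊕ log ladder ⊕ Shapiro) PROVED

Seat `sidea-stub_heegnerIndexLowerAtTwo-3-g30` (planner, stub-ideation, k = 3, technique «decomposition
(split into sub-stubs with a provable glue)») on crux `stmt-BirchSwinnertonDyer-27851`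
(`PrintCf2.SplitBadTwoLowerHalfOfFacts`), stub `stub_heegnerIndexLowerAtTwo` of the LEAD skeleton
(`Lines/kside_finite_two.lean` v2 / work file v3, sha16 `f2bd84c029a8a938`), which is NOT re-typed here.
**BSD is NOT proved by anything in this file; the crux, the stub, R196″, R197a and the (2)₂ identification
are NOT proved here.**  Nothing below is a route, a registry verb or a `Theorems/` proposal.  The file is
Mathlib + tree only and contains no `sorry`, no axiom, no `instance`, no notation.

## What is cut (STUB-PLAN v5.7, g31, 2026-08-29T14:47Z: HARDEST NOW (b) = R197a ⊕ R199 bookkeeping,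
## «the only structural unknown at `v` = R196″'s uniformity-in-n over `L_n/F_n`» — THIS is the target)

R196″ (v5.7): in the projection-free presentation `H¹(F_n, T(key)) = U¹(L_n)^{N=1}` (`F_n = ℚ₂^{ur,2^n}`,
`L_n = F_n(√u)`, `e(L_n/ℚ₂) = 2` for the three ramified key classes `{−1,3}, {2,−6}, {−2,6}`) the critic
expects, uniformly in `n`: «graded pieces below `e′` Frobenius-bijective, at `e′` one Artin–Schreier bit,
above `e′` log-iso; torsion bounded with at most one jump».  The level-wise content of this expectation is
a set of statements about `log₂` on `U¹(L)` for a `2`-adic field `L` with `e = 2` and ARBITRARY residue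
degree `f` — and those are KERNEL-CHECKED TREE THEOREMS, quantified over every such `L` (so uniform in
`n` by construction): §2 instantiates them.  The frame's other wild level `F·ur ⊇ ℚ₂(μ₈)` (`e = 4`, full
ray-class frame, even keys) is covered by the same theorems with different digits (§2, table below).

## The R197a skeleton the glue serves (v5.6 R197 = S1 ↦ v5.7 R197a value identity ⊗ℚ₂; its INTEGRAL
## half is «NOT hardest any more» — the glue below is kept because R196″'s digits ride on the same tower)

R197/R197a: type `Col⁺` on `M⁺ = H¹_Iw(line⁺_v, T_vW)`, `T_vW|_{line⁺} = ℤ₂(1) ⊗ ρ_v`, along the local tower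
`L_m = F·ℚ₂^{ur,2^m}` at `v` (`F` = the finite `v`-level of the frame `𝒢′`; `e_L := e(L_m/ℚ₂)` and
`t := #μ_{2^∞}(L_∞)` are CONSTANT in `m`):  (H4) Kummer, (H1) trace-coherent normal integral basis,
(H2) `log` equivariant with kernel the roots of unity, (H3) UNIFORM radii; by-products = R196′.

## The decomposition (sub-stubs; glue = §1–§3 of this file, PROVED)

* **S1α (Kummer receptacle).** `H¹_Iw(L_∞, ℤ₂(1)) = lim_N (L_mˣ ⊗̂ ℤ₂) = 𝒰_∞ := lim_N U¹(L_m)`, torsion-free: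
  the valuation coordinate dies (`eq_zero_of_forall_eq_mul`: a norm-coherent sequence of valuations is
  divisible by every power of `[L_{m+1}:L_m] = 2`), coherent torsion dies (`eq_one_of_forall_eq_pow`:
  `N = x ↦ x²` on `μ_{2^e} ⊂ F`).  Typer input LF1 = Kummer `H¹(L, ℤ₂(1)) = Lˣ ⊗̂ ℤ₂` (named).
* **S1β (Yager module).** `𝒳 := lim_Tr 𝒪_{L_m}` is free of rank one over `Λ_{𝒪_F}(Γ^{ur})` on a
  trace-coherent system of integral normal basis generators — IN PRINT with a prime-independent proof:
  Loeffler–Zerbes, IJNT 2014 = arXiv:1108.5954, Prop. 3.3 (held text p0008 L26–L43: unramified traces are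
  surjective; ANY trace-compatible lift of a normal basis generator of the bottom layer generates —
  Pickett 2010 via Nakayama over the local ring `k_F[C_{2^n}]`); for the RAMIFIED base `F ∋ μ_{2^e}` of the
  frame reduce by flat base change `𝒪_{L_m} = 𝒪_F ⊗_{ℤ₂} 𝒪_{ℚ₂^{ur,2^m}}`.  Abstract shape of the choice:
  `exists_coherent_of_forall_exists_lift` (dependent choice along surjections, PROVED).
* **S1γ (the log ladder — ALL level-wise inputs are tree theorems by name).** `log ∘ N = Tr ∘ log`
  (`UnitLogNormTrace.unitLog_norm_eq_trace_unitLog`), equivariance (`LocalUnitLogEquivariance.unitLog_map`),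
  kernel = roots of unity (`UnitLogKernel.unitLog_eq_zero_iff`, `UnitLogFibres.unitLog_eq_iff`), inner
  radius `{‖z‖ ≤ ‖ϖ‖^{e_L+1}} ⊆ log(U¹)` with `log : U^{(e_L+1)} ⥲ 𝔭^{e_L+1}` a BIJECTION
  (`LogUnitsRootTwist.closedBall_subset_logUnits_of_mul_rpow_lt_one`, `LogSeriesEstimates.logSeries_injOn`,
  `….logSeries_image_closedBall`; §2 below instantiates them at `p = 2`), outer radius
  `‖log u‖ ≤ ‖ϖ‖^{2^{a₀} − e_L·a₀}` (`UnitLogWildDepth….norm_le_zpow_of_mem_logUnits`), its SHARPNESS for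
  residue degree `≥ 2` (`UnitLogTieAttained….exists_mem_logUnits_norm_eq_zpow_of_tie_of_two_le_residueDegree`).
  LIMIT GLUE (this file): `invLimMap` (= `Λog`), `invLimMap_injective_of_ker_descends` (injective on `𝒰_∞`,
  no `⊗ℚ`, no `lim¹`), `exists_invLim_preimage_of_bijOn` (`ϖ^{e_L+1}·𝒳 ⊆ Λog(𝒰_∞)`),
  `invLimMap_mem_of_forall` (`Λog(𝒰_∞) ⊆ ϖ^{−s₀}·𝒳`), `invLimMap_comm` (equivariance passes to the limit).
* **S1δ (twist; `⊗ℚ₂` only — R197a).** `ρ_v = ρ^{ur}·χ_d` factors through `Gal(L_∞/ℚ₂)` (`ℤ₂ˣ` is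
  pro-2), so `Tw_{ρ_v}` is the algebraic Iwasawa-cohomology twist (Rubin, *Euler Systems* VI §1–2;
  Loeffler–Zerbes §3.4 Prop. 3.14); `Λ(𝒢′) ⊗ ℚ` acts freely of rank one on `𝒳 ⊗ ℚ` (normal basis theorem,
  tree `GaloisAdditiveCohomology.normalBasisLinearEquiv`).  NO integral digit is counted through `e_χ` or an
  inverse resolvent here (B46 / K32): the integral seam between the norm-one presentation and the character
  presentation is R200's located exponent-2 group, not this card's.
* **S1σ (semi-local Shapiro).** `⊕_{w ∣ v}` over the finitely many primes of the frame field above `v`: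
  injectivity and the sandwich hold componentwise (`injective_pi_map`).

## R196″ located — THE KEYED LAW (hand derivation in the card, mechanism kernel-visible in §2b; layer 0
## cross-checked against the tree's `UnitLogWildQuadraticDyadicCases` trichotomy)

`log₂ H¹(F_n, T(key)) = log₂(U¹(L_n)^{N=1}) = 2√u·Im(log₂ U¹(L_n))` equals: `2√u·𝒪_{F_n}` for the EVEN keys
`u ∈ {±2, ±6}` and every `n` (`j(u) = c(u) = 0`, torsion `±1`, no jump); `2i·{c ∈ 𝒪_{F_n} : c̄ ∈ ℘(k_n)}`
(index 2: `j = c = 1`, torsion `μ₄`) for the class `{−1, 3}` whenever `i ∈ L_n` (all `n` for `u = −1`,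
`n ≥ 1` for `u = 3`); `2√3·ℤ₂` at `(u, n) = (3, 0)` (the one jump).  In one line: **`j(u) = c(u) = [i ∈ L_n]`**.
Layer-0 cross-checks (tree, `e = 2`, `f = 1`): `log₂(𝒪ˣ) = 𝔪³ ∪ (λ + 𝔪³)` with `‖λ‖ = ‖ϖ‖` for `ℚ₂(√±2)`,
`ℚ₂(√±6)` (`norm_unitLog_one_add_eq_unif_of_sq_eq`, `logUnits_eq_union_of_norm_eq_half`) ⇒ `Im ∋` unit ✓;
`= 2𝒪` for `ℚ₂(√3)` (`logUnits_eq_closedBall_norm_two_of_sq_eq`) ⇒ `Im = 2ℤ₂ = ℘`-lattice of `𝔽₂` ✓;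
`= 𝔪³` for `ℚ₂(i)` (`logUnits_eq_closedBall_cube_of_sq_eq`) ⇒ `4iℤ₂` = the critic's value ✓.

## R196′ radii located (keyed by `(e_L, t)`; every line a tree theorem instantiated in §2)

`(e_L, t) = (1, 2)` strict unramified line (k1-g27's carrier): `r₀ = 2`, `s₀ = 1` (`log U¹ ⊆ 2𝒪`), Haar
index `[𝔪 : log U¹]_vol = t = 2` (= k1-g27's Artin–Schreier bit, cross-check ✓);
`(2, 4)` (`F·ur = ℚ₂(μ₄)·ur`, keys `d ≡ 3 (4)`): `r₀ = 3` (`𝔭³ ⊆ log U¹`, `UnitLogWildQuadraticDyadic`),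
`s₀ = 0` (`log U¹ ⊆ 𝒪`), attained iff `f ≥ 2` (at `f = 1`: `log(ℤ₂[i]ˣ) = 𝔭³` exactly, `UnitLogDyadicSqrtNegOne`);
`(4, 8)` (`F·ur = ℚ₂(μ₈)·ur`, keys `d` even in the full ray-class frame): `r₀ = 5`, `s₀ = 4`
(`2·log U¹ ⊆ 𝒪`, `log U¹ ⊄ 𝒪` as soon as `f ≥ 2`), Haar index `t = 8`; `(2, 2)` (`ℚ₂(√d)·ur`, `d` even,
`ρ_v`-kernel sub-frame): `r₀ = 3`, `s₀ = 0`, `t = 2`.  LOCATED CORRECTION: R196′'s «log-lattice index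
`c(e)`» is NOT an inclusion index along the tower — `log₂(𝒪_{L_m}ˣ)` is not a ball once `f_m ≥ 2`
(tree `UnitLogUnramifiedDyadic.logUnits_ne_closedBall`, `UnitLogDyadicQuarticFields`) — but the HAAR
identity `vol(log₂ U¹(L_m)) = vol(𝔪_m)/t` (tree `UnitLogVolume.localVolume_real_logUnits_eq_inv_pow`,
`m = torsionPExp = v₂ t`), constant in `m`, together with the sandwich `[r₀, s₀]`.
-/

set_option linter.dupNamespace false
set_option autoImplicit false

noncomputable section

open Metric Set

namespace Summit.BirchSwinnertonDyer.BirchSwinnertonDyer.Cruxes.SplitBadTwoLowerHalfOfFacts.ColPlusS1K3G30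

/-! ## §1  Inverse-limit glue (abstract; PROVED) -/

section InvLim

variable {A : ℕ → Type*} [∀ m, AddCommGroup (A m)]
variable {B : ℕ → Type*} [∀ m, AddCommGroup (B m)]

/-- The inverse limit of a tower of additive groups along transition maps `t m : A (m+1) →+ A m`
(norm on `U¹(L_m)`, trace on `𝒪_{L_m}`, corestriction on `H¹(L_m, ·)`), as a subgroup of the product.
[this file] -/
def invLim (t : ∀ m, A (m + 1) →+ A m) : AddSubgroup (∀ m, A m) where
  carrier := {x | ∀ m, t m (x (m + 1)) = x m}
  add_mem' := by
    intro x y hx hy m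
    simp only [Pi.add_apply, map_add, hx m, hy m]
  zero_mem' := by
    intro m
    simp
  neg_mem' := by
    intro x hx m
    simp only [Pi.neg_apply, map_neg, hx m]

theorem mem_invLim {t : ∀ m, A (m + 1) →+ A m} {x : ∀ m, A m} :
    x ∈ invLim t ↔ ∀ m, t m (x (m + 1)) = x m := Iff.rfl

/-- **`Λog`, abstractly**: a level-wise family `f m : A m →+ B m` (the logarithms `log_m`) commuting
with the transitions (`log ∘ N = Tr ∘ log`, tree `unitLog_norm_eq_trace_unitLog`) induces a homomorphism of
inverse limits. [this file] -/
def invLimMap (t : ∀ m, A (m + 1) →+ A m) (s : ∀ m, B (m + 1) →+ B m) (f : ∀ m, A m →+ B m)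
    (hf : ∀ m (a : A (m + 1)), s m (f (m + 1) a) = f m (t m a)) : invLim t →+ invLim s where
  toFun x := ⟨fun m => f m ((x : ∀ m, A m) m), fun m => by
    have hx : t m ((x : ∀ m, A m) (m + 1)) = (x : ∀ m, A m) m := x.2 m
    show s m (f (m + 1) ((x : ∀ m, A m) (m + 1))) = f m ((x : ∀ m, A m) m)
    rw [hf, hx]⟩
  map_zero' := by
    apply Subtype.ext
    funext m
    simp
  map_add' := by
    intro x y
    apply Subtype.ext
    funext m
    simp

@[simp] theorem invLimMap_apply (t : ∀ m, A (m + 1) →+ A m) (s : ∀ m, B (m + 1) →+ B m)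
    (f : ∀ m, A m →+ B m) (hf : ∀ m (a : A (m + 1)), s m (f (m + 1) a) = f m (t m a))
    (x : invLim t) (m : ℕ) :
    (invLimMap t s f hf x : ∀ m, B m) m = f m ((x : ∀ m, A m) m) := rfl

/-- **S1γ, INJECTIVITY GLUE (integral, no `⊗ℚ`, no `lim¹`).**  Inputs (all level-wise):
`norm_incl` — the transition of an element of the lower level is multiplication by `q = [L_{m+1}:L_m]`
(Mathlib `Algebra.norm_algebraMap`); `ker_descends` — the kernel of `log_{m+1}` (the 2-power roots of
unity, tree `unitLog_eq_zero_iff`) already lies in the lower level (LF5: `μ_{2^∞}(L_∞) = μ_{2^e} ⊂ F`);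
`ker_torsion` — it is killed by `q^e` (tree `card_torsionUnits`).  Output: `Λog` is injective on the
inverse limit `𝒰_∞`. [this file] -/
theorem invLimMap_injective_of_ker_descends (t : ∀ m, A (m + 1) →+ A m) (s : ∀ m, B (m + 1) →+ B m)
    (f : ∀ m, A m →+ B m) (hf : ∀ m (a : A (m + 1)), s m (f (m + 1) a) = f m (t m a))
    (i : ∀ m, A m →+ A (m + 1)) (q e : ℕ)
    (norm_incl : ∀ m (b : A m), t m (i m b) = q • b)
    (ker_descends : ∀ m (a : A (m + 1)), f (m + 1) a = 0 → ∃ b : A m, f m b = 0 ∧ i m b = a)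
    (ker_torsion : ∀ m (a : A m), f m a = 0 → q ^ e • a = 0) :
    Function.Injective (invLimMap t s f hf) := by
  rw [injective_iff_map_eq_zero]
  intro x hx
  have hx' : ∀ m, f m ((x : ∀ m, A m) m) = 0 := fun m => by
    have := congrArg (fun y : invLim s => (y : ∀ m, B m) m) hx
    simpa using this
  -- `x m = q^k • c` with `c ∈ ker (f m)`, for every `k`
  have key : ∀ k m, ∃ c : A m, f m c = 0 ∧ (x : ∀ m, A m) m = q ^ k • c := by
    intro k
    induction k with
    | zero => intro m; exact ⟨(x : ∀ m, A m) m, hx' m, by simp⟩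
    | succ k ih =>
      intro m
      obtain ⟨c', hc', hxc'⟩ := ih (m + 1)
      obtain ⟨c, hc, hic⟩ := ker_descends m c' hc'
      refine ⟨c, hc, ?_⟩
      have hcoh : t m ((x : ∀ m, A m) (m + 1)) = (x : ∀ m, A m) m := x.2 m
      rw [← hcoh, hxc', map_nsmul, ← hic, norm_incl, smul_smul, pow_succ]
  apply Subtype.ext
  funext m
  obtain ⟨c, hc, hxc⟩ := key e m
  rw [hxc, ker_torsion m c hc]
  rfl

/-- **S1γ, INNER-RADIUS GLUE.**  If `log_m` restricts to a BIJECTION `U m → C m` at every level (the deep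
units `U^{(r₀)}(L_m)` onto the ball `𝔭^{r₀}𝒪_{L_m}`, `r₀ = e_L + 1`: tree `logSeries_injOn` +
`logSeries_image_closedBall`, §2) and the norm maps deep units to deep units, then every trace-coherent
`y` with `y m ∈ C m` is `Λog` of a norm-coherent `x` with `x m ∈ U m`:  `ϖ^{r₀}·𝒳 ⊆ Λog(𝒰_∞)`.
[this file] -/
theorem exists_invLim_preimage_of_bijOn (t : ∀ m, A (m + 1) →+ A m) (s : ∀ m, B (m + 1) →+ B m)
    (f : ∀ m, A m →+ B m) (hf : ∀ m (a : A (m + 1)), s m (f (m + 1) a) = f m (t m a))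
    (U : ∀ m, Set (A m)) (C : ∀ m, Set (B m)) (hbij : ∀ m, Set.BijOn (f m) (U m) (C m))
    (norm_deep : ∀ m (a : A (m + 1)), a ∈ U (m + 1) → t m a ∈ U m)
    (y : invLim s) (hy : ∀ m, (y : ∀ m, B m) m ∈ C m) :
    ∃ x : invLim t, (∀ m, (x : ∀ m, A m) m ∈ U m) ∧ invLimMap t s f hf x = y := by
  classical
  -- the unique deep preimage at each level
  set x : ∀ m, A m := fun m => Function.invFunOn (f m) (U m) ((y : ∀ m, B m) m) with hx_def
  have hxU : ∀ m, x m ∈ U m := fun m =>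
    Function.invFunOn_mem ((hbij m).surjOn (hy m))
  have hfx : ∀ m, f m (x m) = (y : ∀ m, B m) m := fun m =>
    Function.invFunOn_eq ((hbij m).surjOn (hy m))
  have hcoh : ∀ m, t m (x (m + 1)) = x m := by
    intro m
    apply (hbij m).injOn (norm_deep m _ (hxU (m + 1))) (hxU m)
    have hy' : s m ((y : ∀ m, B m) (m + 1)) = (y : ∀ m, B m) m := y.2 m
    rw [← hf, hfx (m + 1), hy', hfx m]
  refine ⟨⟨x, hcoh⟩, hxU, ?_⟩
  apply Subtype.ext
  funext m
  simp [hfx m]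

/-- **S1γ, OUTER-RADIUS GLUE** (trivial direction): a level-wise bound `log_m(U¹(L_m)) ⊆ D m`
(`D m = ϖ^{−s₀}𝒪_{L_m}`, tree `norm_le_zpow_of_mem_logUnits`, §2) passes to the limit:
`Λog(𝒰_∞) ⊆ ϖ^{−s₀}·𝒳`. [this file] -/
theorem invLimMap_mem_of_forall (t : ∀ m, A (m + 1) →+ A m) (s : ∀ m, B (m + 1) →+ B m)
    (f : ∀ m, A m →+ B m) (hf : ∀ m (a : A (m + 1)), s m (f (m + 1) a) = f m (t m a))
    (D : ∀ m, Set (B m)) (hD : ∀ m (a : A m), f m a ∈ D m) (x : invLim t) (m : ℕ) :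
    (invLimMap t s f hf x : ∀ m, B m) m ∈ D m := by
  simp [hD]

/-- **S1γ/S1δ, EQUIVARIANCE GLUE**: level-wise endomorphisms `σ` (an element of `Gal(L_∞/ℚ₂)` acting on
units and on the rings, commuting with norm, trace and `log` — tree `unitLog_map`) induce endomorphisms of
the limits, and `Λog` intertwines them. [this file] -/
theorem invLimMap_comm (t : ∀ m, A (m + 1) →+ A m) (s : ∀ m, B (m + 1) →+ B m)
    (f : ∀ m, A m →+ B m) (hf : ∀ m (a : A (m + 1)), s m (f (m + 1) a) = f m (t m a))
    (σA : ∀ m, A m →+ A m) (σB : ∀ m, B m →+ B m)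
    (hσA : ∀ m (a : A (m + 1)), t m (σA (m + 1) a) = σA m (t m a))
    (hσB : ∀ m (b : B (m + 1)), s m (σB (m + 1) b) = σB m (s m b))
    (hσf : ∀ m (a : A m), f m (σA m a) = σB m (f m a)) (x : invLim t) :
    invLimMap t s f hf (invLimMap t t σA hσA x) = invLimMap s s σB hσB (invLimMap t s f hf x) := by
  apply Subtype.ext
  funext m
  simp [hσf]

/-- **S1β, the shape of the choice** (dependent choice along the tower): if generators exist at the bottom
and every generator lifts to a generator one level up along the transition (integral normal basis
generators lift along SURJECTIVE unramified traces and stay generators — Loeffler–Zerbes Prop. 3.3 /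
Pickett), a COHERENT system of generators exists. [this file] -/
theorem exists_coherent_of_forall_exists_lift (t : ∀ m, A (m + 1) →+ A m) (G : ∀ m, Set (A m))
    (h0 : (G 0).Nonempty) (hlift : ∀ m, ∀ a ∈ G m, ∃ b ∈ G (m + 1), t m b = a) :
    ∃ ξ : invLim t, ∀ m, (ξ : ∀ m, A m) m ∈ G m := by
  classical
  -- build the sequence by recursion on the level
  let step : ∀ m, {a : A m // a ∈ G m} → {b : A (m + 1) // b ∈ G (m + 1)} := fun m a =>
    ⟨(hlift m a.1 a.2).choose, (hlift m a.1 a.2).choose_spec.1⟩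
  have hstep : ∀ m (a : {a : A m // a ∈ G m}), t m (step m a).1 = a.1 := fun m a =>
    (hlift m a.1 a.2).choose_spec.2
  let seq : ∀ m, {a : A m // a ∈ G m} := fun m =>
    Nat.rec (motive := fun m => {a : A m // a ∈ G m}) ⟨h0.some, h0.some_mem⟩ (fun m a => step m a) m
  refine ⟨⟨fun m => (seq m).1, fun m => ?_⟩, fun m => (seq m).2⟩
  show t m (seq (m + 1)).1 = (seq m).1
  exact hstep m (seq m)

/-- **S1α, the valuation coordinate dies**: a norm-coherent sequence of valuations satisfies
`v_m = [L_{m+1}:L_m]·v_{m+1}` (unramified layers), hence is divisible by every power of `q ≥ 2`, hence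
vanishes — `lim (ℤ, ×q) = 0`, so `lim_N (L_mˣ ⊗̂ ℤ₂) = lim_N U¹(L_m)`. [this file] -/
theorem eq_zero_of_forall_eq_mul (q : ℤ) (hq : 1 < q) (v : ℕ → ℤ) (hv : ∀ m, v m = q * v (m + 1)) :
    ∀ m, v m = 0 := by
  have hpow : ∀ k m, v m = q ^ k * v (m + k) := by
    intro k
    induction k with
    | zero => intro m; simp
    | succ k ih =>
      intro m
      rw [ih m, hv (m + k), pow_succ, mul_assoc, ← add_assoc]
  intro m
  by_contra hne
  -- `q^k ∣ v m` for every `k`, impossible for `k` large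
  set n := (v m).natAbs with hn
  have hn0 : 0 < n := Int.natAbs_pos.mpr hne
  have hdvd : (q ^ n ∣ v m) := ⟨v (m + n), hpow n m⟩
  have h1 : (q ^ n).natAbs ∣ n := by
    rw [hn]; exact Int.natAbs_dvd_natAbs.mpr hdvd
  have h2 : (q ^ n).natAbs ≤ n := Nat.le_of_dvd hn0 h1
  have hq2 : 2 ≤ q.natAbs := by
    have : (2 : ℤ) ≤ q := hq
    omega
  have h3 : 2 ^ n ≤ (q ^ n).natAbs := by
    rw [Int.natAbs_pow]
    exact Nat.pow_le_pow_left hq2 n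
  have h4 : n < 2 ^ n := Nat.lt_two_pow_self
  omega

/-- **S1α, coherent torsion dies**: on the 2-power roots of unity `μ_{2^e} ⊂ F ⊆ L_m` the norm of the
unramified layer is `x ↦ x^q`, so a norm-coherent sequence of them is `x_m = x_{m+k}^{q^k} = 1`:
`𝒰_∞` is torsion-free although every `U¹(L_m)` has torsion `μ_{2^e}`. [this file] -/
theorem eq_one_of_forall_eq_pow {M : Type*} [Monoid M] (q e : ℕ) (hM : ∀ g : M, g ^ q ^ e = 1)
    (x : ℕ → M) (hx : ∀ m, x m = x (m + 1) ^ q) : ∀ m, x m = 1 := by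
  have hpow : ∀ k m, x m = x (m + k) ^ q ^ k := by
    intro k
    induction k with
    | zero => intro m; simp
    | succ k ih =>
      intro m
      rw [ih m, hx (m + k), ← pow_mul, ← add_assoc, pow_succ']
  intro m
  rw [hpow e m, hM]

/-- **S1σ (semi-local Shapiro)**: over the finitely many primes of the frame field above `v` everything is
a finite product; injectivity (and, verbatim, the sandwich) is componentwise. [this file] -/
theorem injective_pi_map {ι : Type*} {X Y : ι → Type*} (g : ∀ j, X j → Y j)
    (hg : ∀ j, Function.Injective (g j)) :
    Function.Injective (fun (x : ∀ j, X j) (j : ι) => g j (x j)) := by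
  intro x y hxy
  funext j
  exact hg j (congrFun hxy j)

/-- **B46 NORM-ONE PRESENTATION GLUE** (`H¹(F_n, T(key)) = U¹(L_n)^{N=1}`, projection-free, no `½`,
no `e_χ`).  Level-wise and written additively: `f` = `log_{L_n}` with a bijection `U → C` (deep units onto
the inner ball, §2), `f'` = `log_{F_n}`, `N` = norm, `Tr` = trace, `comm` = `log ∘ N = Tr ∘ log` (tree
`unitLog_norm_eq_trace_unitLog`), `N(U) ⊆ U'` (`N(1 + 𝔭_L³) ⊆ 1 + 4𝒪_F`) and `f'` injective on `U'`
(`−1 ∉ 1 + 4𝒪_F`: the kernel of `log_F` on units is `{±1}`, tree `unitLog_eq_zero_iff`).  THEN every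
trace-zero element of the inner ball is the logarithm of a NORM-ONE deep unit:
`C ∩ ker Tr ⊆ log(U ∩ {N = 1})` — the «above `e′` log-iso» piece of R196″ restricted to the norm-one
presentation, uniformly in `n`. [this file] -/
theorem exists_normOne_preimage {A₀ A₁ B₀ B₁ : Type*} [AddCommGroup A₀] [AddCommGroup A₁]
    [AddCommGroup B₀] [AddCommGroup B₁] (f : A₁ →+ B₁) (f' : A₀ →+ B₀) (N : A₁ →+ A₀) (Tr : B₁ →+ B₀)
    (comm : ∀ a, f' (N a) = Tr (f a)) (U : Set A₁) (C : Set B₁) (hbij : Set.BijOn f U C)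
    (U' : Set A₀) (hNU : ∀ a ∈ U, N a ∈ U') (hinj : ∀ a' ∈ U', f' a' = 0 → a' = 0)
    (c : B₁) (hc : c ∈ C) (hTr : Tr c = 0) :
    ∃ u ∈ U, N u = 0 ∧ f u = c := by
  obtain ⟨u, hu, rfl⟩ := hbij.surjOn hc
  refine ⟨u, hu, hinj _ (hNU u hu) ?_, rfl⟩
  rw [comm, hTr]

/-- … and in the limit: a family of level-wise «norm-one» conditions cut out a subgroup of `invLim t`
on which `Λog` stays injective (restriction of an injective map). [this file] -/
theorem injective_restrict_of_injective {X Y : Type*} [AddCommGroup X] [AddCommGroup Y] (g : X →+ Y)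
    (hg : Function.Injective g) (S : AddSubgroup X) : Function.Injective (g.comp S.subtype) :=
  hg.comp Subtype.val_injective

end InvLim

/-! ## §2  The level-wise inputs at `p = 2` ARE tree theorems: radii, sharpness, bijection, Haar digit -/

section Digits

open Literature.IUT.LogVolume Literature.NumberTheory.GaloisRepresentations.Ultrametric

variable {K : Type*} [NontriviallyNormedField K] [NormedAlgebra ℚ_[2] K] [IsUltrametricDist K]
  [ProperSpace K]

/-- **OUTER RADIUS at `e_L = 2`** (lines `(2, t)`: `F·ur ⊇ ℚ₂(μ₄)` or `ℚ₂(√d)`, `d` even): `s₀ = 0`, i.e.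
`log₂(𝒪_Lˣ) ⊆ 𝒪_L`, uniformly in the residue degree (hence along the whole unramified tower).
Tree `norm_le_zpow_of_mem_logUnits` with turning point `a₀ = 1`. [this file, from the tree] -/
theorem norm_le_one_of_mem_logUnits_of_absRamificationIdx_eq_two {ϖ : Kˣ} (hϖ : IsUniformizer ϖ)
    (he : absRamificationIdx 2 K = 2) {z : K} (hz : z ∈ logUnits K) : ‖z‖ ≤ 1 := by
  have h := RamificationCriterion.norm_le_zpow_of_mem_logUnits 2 hϖ (a₀ := 1)
    (fun a ha => by interval_cases a; rw [he]; norm_num) (by rw [he]; norm_num) hz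
  rw [he] at h
  norm_num at h
  exact h

/-- **OUTER RADIUS at `e_L = 4`** (line `(4, 8)`: `F·ur ⊇ ℚ₂(μ₈)`, keys `d` even in the full ray-class
frame): `s₀ = 4 = e_L`, i.e. `‖log₂ u‖ ≤ ‖ϖ‖^{−4} = 2`.  Tree `norm_le_zpow_of_mem_logUnits`, `a₀ = 2`.
[this file, from the tree] -/
theorem norm_le_zpow_neg_four_of_mem_logUnits_of_absRamificationIdx_eq_four {ϖ : Kˣ}
    (hϖ : IsUniformizer ϖ) (he : absRamificationIdx 2 K = 4) {z : K} (hz : z ∈ logUnits K) :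
    ‖z‖ ≤ ‖(ϖ : K)‖ ^ (-4 : ℤ) := by
  have h := RamificationCriterion.norm_le_zpow_of_mem_logUnits 2 hϖ (a₀ := 2)
    (fun a ha => by interval_cases a <;> (rw [he]; norm_num)) (by rw [he]; norm_num) hz
  rw [he] at h
  norm_num at h
  exact h

/-- … equivalently `2·log₂(𝒪_Lˣ) ⊆ 𝒪_L` at `e_L = 4` (`‖2‖ = ‖ϖ‖⁴`). [this file, from the tree] -/
theorem norm_two_mul_le_one_of_mem_logUnits_of_absRamificationIdx_eq_four {ϖ : Kˣ}
    (hϖ : IsUniformizer ϖ) (he : absRamificationIdx 2 K = 4) {z : K} (hz : z ∈ logUnits K) :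
    ‖(2 : K) * z‖ ≤ 1 := by
  have h := norm_le_zpow_neg_four_of_mem_logUnits_of_absRamificationIdx_eq_four hϖ he hz
  have h2 : ‖(2 : K)‖ = ‖(ϖ : K)‖ ^ 4 := by
    have := norm_prime_eq_norm_pow 2 K hϖ
    rw [he] at this
    exact_mod_cast this
  have hρ0 : 0 < ‖(ϖ : K)‖ := norm_units_pos ϖ
  rw [norm_mul, h2]
  calc ‖(ϖ : K)‖ ^ 4 * ‖z‖ ≤ ‖(ϖ : K)‖ ^ 4 * ‖(ϖ : K)‖ ^ (-4 : ℤ) := by gcongr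
    _ = 1 := by
      rw [zpow_neg, ← zpow_natCast]
      push_cast
      exact mul_inv_cancel₀ (zpow_ne_zero 4 hρ0.ne')

/-- **SHARPNESS of `s₀ = 0` at `e_L = 2` for residue degree `f ≥ 2`** (every layer `m ≥ 1` of the tower):
some unit has a UNIT logarithm — `log₂ U¹ ⊄ 𝔪`.  (At `f = 1`, `ℚ₂(i)`: `log(ℤ₂[i]ˣ) = 𝔭³`, tree
`UnitLogDyadicSqrtNegOne` — the extremal layer `m = 0` is different.)  Tree tie theorem, `(s, a₀) = (1, 1)`.
[this file, from the tree] -/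
theorem exists_mem_logUnits_norm_eq_one_of_absRamificationIdx_eq_two {ϖ : Kˣ} (hϖ : IsUniformizer ϖ)
    (he : absRamificationIdx 2 K = 2) (hf : 2 ≤ residueDegree 2 K) :
    ∃ z ∈ logUnits K, ‖z‖ = 1 := by
  obtain ⟨z, hz, hzn⟩ :=
    ValuationProfile.exists_mem_logUnits_norm_eq_zpow_of_tie_of_two_le_residueDegree 2 hϖ (s := 1)
      le_rfl (a₀ := 1) (by rw [he]; norm_num) hf
  refine ⟨z, hz, ?_⟩
  rw [hzn, he]
  norm_num

/-- **SHARPNESS of `s₀ = 4` at `e_L = 4` for `f ≥ 2`**: some unit logarithm has norm EXACTLY `‖ϖ‖^{−4} = 2`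
— on the line `(4, 8)` the integral structure `log U¹ ⊆ 𝒪` FAILS from layer `m ≥ 1` on (a phenomenon
absent on k1-g27's unramified line and on the quadratic lines).  Tree tie theorem, `(s, a₀) = (1, 2)`.
[this file, from the tree] -/
theorem exists_mem_logUnits_norm_eq_zpow_neg_four_of_absRamificationIdx_eq_four {ϖ : Kˣ}
    (hϖ : IsUniformizer ϖ) (he : absRamificationIdx 2 K = 4) (hf : 2 ≤ residueDegree 2 K) :
    ∃ z ∈ logUnits K, ‖z‖ = ‖(ϖ : K)‖ ^ (-4 : ℤ) := by
  obtain ⟨z, hz, hzn⟩ :=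
    ValuationProfile.exists_mem_logUnits_norm_eq_zpow_of_tie_of_two_le_residueDegree 2 hϖ (s := 1)
      le_rfl (a₀ := 2) (by rw [he]; norm_num) hf
  refine ⟨z, hz, ?_⟩
  rw [hzn, he]
  norm_num

/-- **INNER RADIUS, every `e_L`** (`r₀ = e_L + 1`): `{‖z‖ ≤ ‖ϖ‖^{e_L+1}} ⊆ log₂(𝒪_Lˣ)` — the radius form
of Neukirch II (5.5) at `p = 2` (`‖ϖ‖^{e_L+1}·2 = ‖ϖ‖ < 1`).  Tree `closedBall_subset_logUnits_of_mul_rpow_lt_one`.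
[this file, from the tree] -/
theorem closedBall_pow_succ_subset_logUnits {ϖ : Kˣ} (hϖ : IsUniformizer ϖ) :
    closedBall (0 : K) (‖(ϖ : K)‖ ^ (absRamificationIdx 2 K + 1)) ⊆ logUnits K := by
  refine closedBall_subset_logUnits_of_mul_rpow_lt_one 2 ?_
  have h1 : ‖(ϖ : K)‖ ^ absRamificationIdx 2 K = ((2 : ℕ) : ℝ)⁻¹ := norm_pow_absRamificationIdx 2 K hϖ
  have hlt : ‖(ϖ : K)‖ < 1 := hϖ.1
  have hrpow : ((2 : ℕ) : ℝ) ^ (1 / (((2 : ℕ) : ℝ) - 1)) = 2 := by norm_num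
  rw [hrpow, pow_succ, h1]
  push_cast
  linarith

/-- … in particular at `e_L = 2`: `𝔭³ ⊆ log₂(𝒪_Lˣ)` — the tree's dyadic-quadratic form, cited verbatim
(`UnitLogWildQuadraticDyadic.closedBall_subset_logUnits`). [this file, from the tree] -/
theorem closedBall_cube_subset_logUnits_of_absRamificationIdx_eq_two [CompleteSpace K] {ϖ : Kˣ}
    (hϖ : IsUniformizer ϖ) (he : absRamificationIdx 2 K = 2) :
    closedBall (0 : K) (‖(ϖ : K)‖ ^ 3) ⊆ logUnits K :=
  WildQuadraticDyadic.closedBall_subset_logUnits hϖ he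

/-- **R196″ UNIFORMITY AT `e = 2`, ONE LINE**: for EVERY `2`-adic field with `e = 2` — in particular every
layer `L_n = ℚ₂^{ur,2^n}(√u)` of the keyed tower, whatever `n` — `𝔭³ ⊆ log₂(𝒪ˣ) ⊆ 𝒪`: the radii do not
move with `n`. [this file, from the tree] -/
theorem logUnits_sandwich_of_absRamificationIdx_eq_two [CompleteSpace K] {ϖ : Kˣ} (hϖ : IsUniformizer ϖ)
    (he : absRamificationIdx 2 K = 2) :
    closedBall (0 : K) (‖(ϖ : K)‖ ^ 3) ⊆ logUnits K ∧ logUnits K ⊆ closedBall (0 : K) 1 :=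
  ⟨WildQuadraticDyadic.closedBall_subset_logUnits hϖ he, fun _ hz =>
    mem_closedBall_zero_iff.mpr (norm_le_one_of_mem_logUnits_of_absRamificationIdx_eq_two hϖ he hz)⟩

/-- **THE LEVEL-WISE BIJECTION `log : U^{(e_L+1)} ⥲ 𝔭^{e_L+1}`** (input `bij` of the inner-radius glue
`exists_invLim_preimage_of_bijOn`): the series `L` is injective on `{‖1 − y‖ ≤ ‖ϖ‖^{e_L+1}}` and maps it
ONTO `{‖z‖ ≤ ‖ϖ‖^{e_L+1}}` (tree `logSeries_injOn`, `logSeries_image_closedBall`; on principal units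
`unitLog = logSeries`, tree `unitLog_of_isPrincipal`). [this file, from the tree] -/
theorem logSeries_bijOn_deep {ϖ : Kˣ} (hϖ : IsUniformizer ϖ) :
    Set.BijOn (logSeries (K := K)) {y : K | ‖1 - y‖ ≤ ‖(ϖ : K)‖ ^ (absRamificationIdx 2 K + 1)}
      {z : K | ‖z‖ ≤ ‖(ϖ : K)‖ ^ (absRamificationIdx 2 K + 1)} := by
  have h1 : ‖(ϖ : K)‖ ^ absRamificationIdx 2 K = ((2 : ℕ) : ℝ)⁻¹ := norm_pow_absRamificationIdx 2 K hϖ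
  have hlt : ‖(ϖ : K)‖ < 1 := hϖ.1
  have hθ : ‖(ϖ : K)‖ ^ (absRamificationIdx 2 K + 1) * ((2 : ℕ) : ℝ) ^ (1 / (((2 : ℕ) : ℝ) - 1)) < 1 := by
    have hrpow : ((2 : ℕ) : ℝ) ^ (1 / (((2 : ℕ) : ℝ) - 1)) = 2 := by norm_num
    rw [hrpow, pow_succ, h1]
    push_cast
    linarith
  have himg := logSeries_image_closedBall 2 K hθ
  have hinj := logSeries_injOn 2 K hθ
  rw [← himg]
  exact hinj.bijOn_image

/-- **THE HAAR DIGIT** (what R196′'s «log-lattice index `c(e)`» must mean): `vol(log₂(𝒪_Lˣ)) = 2^{−(f+m)}`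
with `vol(𝒪_L) = 1`, `2^m = t = #μ_{2^∞}(L)` — i.e. `[𝔪_L : log₂ U¹(L)]_vol = t`, CONSTANT along the
unramified tower, although `log₂ U¹(L_m)` is not a ball once `f_m ≥ 2`.  Tree
`localVolume_real_logUnits_eq_inv_pow` ([IUTchIV] Prop. 1.4 (ii), classical). [this file, from the tree] -/
theorem haarDigit_logUnits [MeasurableSpace K] [BorelSpace K] :
    (localVolume K (logUnits K)).toReal = (((2 : ℕ) : ℝ) ^ (residueDegree 2 K + torsionPExp 2 K))⁻¹ :=
  localVolume_real_logUnits_eq_inv_pow 2 K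

/-- The digit arithmetic of the table (turning points and exponents of `h(a) = 2ᵃ − e_L·a`):
`(e_L; a₀, s₀, r₀) = (1; 0, 1, 2), (2; 1, 0, 3), (4; 2, −4 ↦ s₀ = 4, 5)`. [this file] -/
theorem digitTable :
    ((1 : ℤ) * 2 ^ 0 - 1 * 0 = 1 ∧ (1 : ℤ) * 2 ^ 1 - 2 * 1 = 0 ∧ (1 : ℤ) * 2 ^ 2 - 4 * 2 = -4) ∧
    (1 + 1 = 2 ∧ 2 + 1 = 3 ∧ 4 + 1 = 5) := by
  norm_num

/-! ### §2b  The keyed dichotomy behind R196″'s `j(u) = c(u) = [i ∈ L_n]` (ring identities; PROVED)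

In the projection-free presentation `H¹(F_n, T(key)) = U¹(L_n)^{N=1} = ±{x/x̄}` (Hilbert 90; `π/π̄ = −1` for
`π = √u`, `u` even; `= i` for `π = 1 + i`), `log(x/x̄) = 2·Im(log x)·√u`, so the keyed lattice is
`2√u · Im(log₂ U¹(L_n))`, and `Im ∘ log` on `U¹/U²` is read off the imaginary coordinate of SQUARING
(`log x = ½ log x²`, `x² ∈ U² = 1 + 2𝒪`, where `log(1 + 2z) ≡ 2z (mod 4z²)`):  for `u` EVEN the imaginary
coordinate of `(1 + a√u)²` is `2a` — LINEAR in `a`, so `Im(log U¹(L_n)) = 𝒪_{F_n}` and the lattice is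
`2√u·𝒪_{F_n}` for every `n` (no Artin–Schreier bit: `j = c = 0`, torsion `±1`, no jump); for the class
`{−1, 3}` (`L_n ∋ i`, `π = 1 + i`) it is `2(a + a²) = 2℘(a)` — ARTIN–SCHREIER, so `Im(log U¹(L_n))` is the
index-2 lattice `{c : c̄ ∈ ℘(k_n)}` (k1-g27's universal bit, now on the ramified keyed line) and
`j = c = 1` for every `n` with `i ∈ L_n` (all `n` for `u = −1`; `n ≥ 1` for `u = 3` — the one jump). -/

/-- Even keys: the imaginary coordinate of `(1 + a·s)²`, `s² = u`, is `2a` (linear). [this file] -/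
theorem sq_one_add_mul_sqrt {R : Type*} [CommRing R] (a s u : R) (hs : s * s = u) :
    (1 + a * s) ^ 2 = (1 + a ^ 2 * u) + (2 * a) * s := by
  linear_combination (a ^ 2) * hs

/-- Class `{−1, 3}`: the imaginary coordinate of `(1 + a·(1 + i))²`, `i² = −1`, is `2(a + a²)` — the
Artin–Schreier polynomial `℘(a) = a² + a`. [this file] -/
theorem sq_one_add_mul_one_add_I {R : Type*} [CommRing R] (a i : R) (hi : i * i = -1) :
    (1 + a * (1 + i)) ^ 2 = (1 + 2 * a) + (2 * (a + a ^ 2)) * i := by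
  linear_combination (a ^ 2) * hi

/-- … and `log(x/x̄)` only sees twice the imaginary part: in coordinates `x = α + β·s`, `x̄ = α − β·s`,
the antisymmetrisation `ℓ(x) − ℓ(x̄)` of any additive `ℓ` commuting with conjugation is `2·(Im ℓ(x))·s`.
Abstract form: an additive map `ℓ` with `ℓ ∘ σ = σ ∘ ℓ` for an involution `σ` sends `x − σ x` into the
`(−1)`-eigenspace, and `y − σ y = 2y` there. [this file] -/
theorem sub_conj_eq_two_smul {M : Type*} [AddCommGroup M] (σ : M →+ M) (y : M) (hy : σ y = -y) :
    y - σ y = 2 • y := by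
  rw [hy, sub_neg_eq_add, two_nsmul]

end Digits

/-! ## §3  The glue assembled: the sub-stubs as the fields of one datum, `Λog` with its three properties -/

section Assembly

variable {A : ℕ → Type*} [∀ m, AddCommGroup (A m)]
variable {B : ℕ → Type*} [∀ m, AddCommGroup (B m)]

/-- **THE LOG-TOWER DATUM of line⁺ at `v`** — its fields ARE the sub-stubs (each with its tree / print
source in the docstring of the field's consumer above): `t` = norms on `A m = U¹(L_m)` written additively
(S1α), `s` = traces on `B m = ϖ^{−s₀}𝒪_{L_m}` (S1β), `f` = `log_m` (tree `unitLog`), `comm` = tree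
`unitLog_norm_eq_trace_unitLog`, `i` = inclusions, `norm_incl` = Mathlib `Algebra.norm_algebraMap`,
`ker_descends`/`ker_torsion` = tree `unitLog_eq_zero_iff` + `card_torsionUnits` + LF5, `U`/`C`/`bij` =
deep units / inner ball / `logSeries_bijOn_deep` (§2), `norm_deep` = `N(1 + 𝔭^r) ⊆ 1 + 𝔭^r`. [this file] -/
structure LogTowerDatum (A B : ℕ → Type*) [∀ m, AddCommGroup (A m)] [∀ m, AddCommGroup (B m)] where
  t : ∀ m, A (m + 1) →+ A m
  s : ∀ m, B (m + 1) →+ B m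
  f : ∀ m, A m →+ B m
  comm : ∀ m (a : A (m + 1)), s m (f (m + 1) a) = f m (t m a)
  i : ∀ m, A m →+ A (m + 1)
  q : ℕ
  e : ℕ
  norm_incl : ∀ m (b : A m), t m (i m b) = q • b
  ker_descends : ∀ m (a : A (m + 1)), f (m + 1) a = 0 → ∃ b : A m, f m b = 0 ∧ i m b = a
  ker_torsion : ∀ m (a : A m), f m a = 0 → q ^ e • a = 0
  U : ∀ m, Set (A m)
  C : ∀ m, Set (B m)
  bij : ∀ m, Set.BijOn (f m) (U m) (C m)
  norm_deep : ∀ m (a : A (m + 1)), a ∈ U (m + 1) → t m a ∈ U m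

namespace LogTowerDatum

variable (𝒟 : LogTowerDatum A B)

/-- `Λog : 𝒰_∞ → ϖ^{−s₀}·𝒳`, the limit of the level-wise logarithms. [this file] -/
def Λog : invLim 𝒟.t →+ invLim 𝒟.s := invLimMap 𝒟.t 𝒟.s 𝒟.f 𝒟.comm

/-- **`Λog` is injective** (integrally). [this file] -/
theorem Λog_injective : Function.Injective 𝒟.Λog :=
  invLimMap_injective_of_ker_descends 𝒟.t 𝒟.s 𝒟.f 𝒟.comm 𝒟.i 𝒟.q 𝒟.e 𝒟.norm_incl 𝒟.ker_descends
    𝒟.ker_torsion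

/-- **`Λog` hits the inner limit lattice**: `lim_Tr 𝔭^{r₀}𝒪_{L_m} ⊆ Λog(𝒰_∞)`. [this file] -/
theorem Λog_onto_inner (y : invLim 𝒟.s) (hy : ∀ m, (y : ∀ m, B m) m ∈ 𝒟.C m) :
    ∃ x : invLim 𝒟.t, (∀ m, (x : ∀ m, A m) m ∈ 𝒟.U m) ∧ 𝒟.Λog x = y :=
  exists_invLim_preimage_of_bijOn 𝒟.t 𝒟.s 𝒟.f 𝒟.comm 𝒟.U 𝒟.C 𝒟.bij 𝒟.norm_deep y hy

/-- **R197's `⊗ℚ` statements follow** from the two integral ones: an injective map whose image contains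
`ϖ^{r₀}` times the target lattice is an isomorphism after `⊗ℚ`; here is the lattice-free shadow the critic's
`hCol_of_linear` consumes — `Λog x = 0 ↔ x = 0`. [this file] -/
theorem Λog_eq_zero_iff (x : invLim 𝒟.t) : 𝒟.Λog x = 0 ↔ x = 0 :=
  ⟨fun h => 𝒟.Λog_injective (by rw [h, map_zero]), fun h => by rw [h, map_zero]⟩

end LogTowerDatum

end Assembly

end Summit.BirchSwinnertonDyer.BirchSwinnertonDyer.Cruxes.SplitBadTwoLowerHalfOfFacts.ColPlusS1K3G30

end
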